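import Mathlib
import HarnessLib
import Summits.QuantumFields.YangMills.Theorems.ComplexCouplingChannelContinuumLegGivenGapAlternatingArraysDefs
import Summits.QuantumFields.YangMills.Theorems.ComplexCouplingChannelContinuumLegGivenGapProductToUniformLinearity
import Summits.QuantumFields.YangMills.Theorems.ComplexCouplingChannelContinuumLegGivenGapProductToUniformNearDiagonal
import Summits.QuantumFields.YangMills.Theorems.ComplexCouplingChannelContinuumLegGivenGapProductToUniformOffsets
import Summits.QuantumFields.YangMills.Theorems.ComplexCouplingChannelContinuumLegGivenGapProductToUniformLocalBound
import Summits.QuantumFields.YangMills.Theorems.ComplexCouplingChannelContinuumLegGivenGapProductToUniformGevreyGlue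
import Summits.QuantumFields.YangMills.Theorems.ComplexCouplingChannelContinuumLegGivenGapProductToUniformGevreyStep

/-!
# `stub_productToUniform` ((PB) ⇒ (UUVB)) of line `alternating-curvature-arrays` (crux `ContinuumLegGivenGap`,
stmt-QuantumFields-15828): the WHITNEY SYSTEM — definitions

Route-posited objects of the sub-skeleton of `stub_productToUniform` (lead c14 / worker W3, 2026-08-17; crux workfile
`Cruxes/ContinuumLegGivenGap/Lines/alternating_curvature_arrays.lean` §3c), landed as a reviewed Defs file so that the
registered pieces `ptu_geometry`, `ptu_derivatives`, `ptu_analysis`, `ptu_assembly` can be stated and proved under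
`Theorems/`.  Whitney decomposition of an off-diagonal test function on `(ℝ⁴)^p` by ADMISSIBLE DEEP CORES of the
alternating cell grids with ONE global normaliser:
* `ptuStep` — the Gevrey-2 smooth step of the landed `gstep_exists` (fixed by choice; `ptuStep_spec`, the registered
  anchor of this file); `ptuPlateau lo hi w` — the plateau bump `θ((t-lo)/w) θ((hi-t)/w)`;
* numerics: offset step `ptuD m p = ⌊3^m / (2(2p+1))⌋`, finest level `ptuM0 p` (`3^{m₀} > 64(2p+1)`), near radius
  `ptuR p = 36·3^{m₀}` (lattice units);
* one-point cut-offs of the level-`m` cell `z` of the grid with offset `v` at spacing `a`: `ptuCut` (depth `e`, ramp `w`),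
  the INNER cut-off `ptuChiFun` (depth `2 + d/8`, ramp `d/8`, supported in the core `physCore`; Schwartz version `ptuChi`)
  and the OUTER cut-off `ptuChiTildeFun` (depth `2`, `= 1` on the support of the inner one);
* configuration-space weights on `(ℝ⁴)^p`: tensor bumps `ptuPhiStar`, `ptuPhiTilde`; the NEAR weight `ptuNear`; the OUTER
  weight `ptuOut`; index sets `ptuOffsets`, `ptuCellBox`, `ptuIdx` (offset + cell assignment in the central half-box, pairwise
  `≥ 16` apart, closest pair `≤ 56`: the scale window), Whitney levels `ptuLevels`; the global normaliser
  `ptuW = near + out + ∑ φ*` and the piece weights `ptuWeight = φ̃ / W`;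
* small regularity lemmas (plateau / cut-off smoothness, ranges, supports; `ptuChi` is a genuine `𝓢(ℝ⁴, ℝ)`).
Design rationale and the statements of the pieces: crux workfile §3c.  NOT here: the pieces, the lattice decomposition
identity and the arity-0/1 facts (separate proof file), the assembly. [folklore]
-/

set_option autoImplicit false

noncomputable section

open scoped Classical

namespace Summit.QuantumFields.YangMills.Theorems.ContinuumLegGivenGap

open scoped SchwartzMap BigOperators ContDiff
open MeasureTheory Filter Topology
open Literature.MathematicalPhysics.QuantumFieldTheory Literature.MathematicalPhysics.QuantumLattice
  Literature.MathematicalPhysics.AQFT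
open Literature.Probability.LatticeModels (box Site)
open Summit.QuantumFields.YangMills.Cruxes.ContinuumLimitOnTrajectory.TwoOrbitSynchronisation
  (PlaqIdx plaq canonDistribution UUVB PolyVolumeGrowth)
open Summit.QuantumFields.YangMills.Theorems.ContinuumLimitExists.Negative (obsOf centredMoment)
open Summit.QuantumFields.YangMills.Theorems.ContinuumLegGivenGap.AlternatingArrays

/-! ## §1 Shared definitions -/

/-- The universal one-dimensional profile: the smooth step `θ` of Gevrey class 2 delivered by `gstep_exists`
(`= 0` on `x ≤ 0`, `= 1` on `x ≥ 1`, values in `[0,1]`, monotone, `|θ⁽ⁿ⁾| ≤ 2¹⁴ 18ⁿ (n!)²`), fixed once by choice.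
[folklore] -/
def ptuStep : ℝ → ℝ := Classical.choose gstep_exists

/-- The specification of `ptuStep`. [folklore] -/
theorem ptuStep_spec : ContDiff ℝ ∞ ptuStep ∧ (∀ x, x ≤ 0 → ptuStep x = 0) ∧ (∀ x, 1 ≤ x → ptuStep x = 1) ∧
    (∀ x, 0 ≤ ptuStep x ∧ ptuStep x ≤ 1) ∧ Monotone ptuStep ∧
    ∀ (n : ℕ) (x : ℝ), |iteratedDeriv n ptuStep x| ≤ 2 ^ 14 * 18 ^ n * (n.factorial : ℝ) ^ 2 :=
  Classical.choose_spec gstep_exists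

/-- The plateau bump `θ((t - lo)/w) · θ((hi - t)/w)`: for `w > 0` it vanishes off `(lo, hi)` and equals `1` on
`[lo + w, hi - w]`. [folklore] -/
def ptuPlateau (lo hi w t : ℝ) : ℝ := ptuStep ((t - lo) / w) * ptuStep ((hi - t) / w)

/-- The offset step `d(m,p) = ⌊3^m / (2(2p+1))⌋` (lattice units): `(2p+1) d ≤ 3^m/2 = cellSide m`. [folklore] -/
def ptuD (m p : ℕ) : ℕ := 3 ^ m / (2 * (2 * p + 1))

/-- The finest Whitney level `m₀(p) = log₃(64(2p+1)) + 1`, so that `3^{m₀} > 64(2p+1)` and `d(m,p) ≥ 32` for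
`m ≥ m₀`. [folklore] -/
def ptuM0 (p : ℕ) : ℕ := Nat.log 3 (64 * (2 * p + 1)) + 1

/-- The near radius `R(p) = 36·3^{m₀(p)}` (lattice units): configurations with a pair closer than `R a` in sup norm are
`near`. [folklore] -/
def ptuR (p : ℕ) : ℕ := 36 * 3 ^ ptuM0 p

/-- One-point cut-off of the level-`m` cell `z` of the grid with integer offset `v`, at depth `e` with ramp `w` (lattice
units), physical spacing `a`: `∏_μ plateau(a(v_μ + S z_μ + e), a(v_μ + S(z_μ+1) - e), a w)(u_μ)`, `S = cellSide m`.
[folklore] -/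
def ptuCut (a : ℝ) (m : ℕ) (v z : Fin 4 → ℤ) (e w : ℝ) (u : EuclideanSpace ℝ (Fin 4)) : ℝ :=
  ∏ μ : Fin 4, ptuPlateau (a * ((v μ : ℝ) + cellSide m * (z μ : ℝ) + e))
    (a * ((v μ : ℝ) + cellSide m * ((z μ : ℝ) + 1) - e)) (a * w) (u μ)

/-- The INNER cut-off `χ` of cell `z` (depth `2 + d/8`, ramp `d/8`): supported in the core `physCore a m v z`, equal to `1`
at depth `≥ 2 + d/4`. [folklore] -/
def ptuChiFun (a : ℝ) (m p : ℕ) (v z : Fin 4 → ℤ) : EuclideanSpace ℝ (Fin 4) → ℝ :=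
  ptuCut a m v z (2 + (ptuD m p : ℝ) / 8) ((ptuD m p : ℝ) / 8)

/-- The OUTER cut-off `χ̃` of cell `z` (depth `2`, ramp `d/8`): equal to `1` on the support of the inner one, supported in
the core. [folklore] -/
def ptuChiTildeFun (a : ℝ) (m p : ℕ) (v z : Fin 4 → ℤ) : EuclideanSpace ℝ (Fin 4) → ℝ :=
  ptuCut a m v z 2 ((ptuD m p : ℝ) / 8)

/-- The tensor bump `φ*_{m,v,z}(y) = ∏ᵢ χ_{zᵢ}(yᵢ)`. [folklore] -/
def ptuPhiStar (a : ℝ) (m p : ℕ) (v : Fin 4 → ℤ) (z : Fin p → Fin 4 → ℤ) (y : (Fin p → EuclideanSpace ℝ (Fin 4))) : ℝ :=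
  ∏ i, ptuChiFun a m p v (z i) (y i)

/-- The enlarged tensor bump `φ̃_{m,v,z}(y) = ∏ᵢ χ̃_{zᵢ}(yᵢ)` (`= 1` on the support of `φ*`). [folklore] -/
def ptuPhiTilde (a : ℝ) (m p : ℕ) (v : Fin 4 → ℤ) (z : Fin p → Fin 4 → ℤ) (y : (Fin p → EuclideanSpace ℝ (Fin 4))) : ℝ :=
  ∏ i, ptuChiTildeFun a m p v (z i) (y i)

/-- The NEAR weight: `1 - ∏_{i<j} (1 - ∏_μ plateau(-Ra, Ra, Ra/4)((yᵢ - yⱼ)_μ))`; `= 1` iff some pair is within `3Ra/4`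
in sup norm, `= 0` iff every pair is `≥ Ra` apart, smooth. [folklore] -/
def ptuNear (a : ℝ) (p : ℕ) (y : (Fin p → EuclideanSpace ℝ (Fin 4))) : ℝ :=
  1 - ∏ ij ∈ (Finset.univ : Finset (Fin p × Fin p)).filter (fun ij => ij.1 < ij.2),
    (1 - ∏ μ : Fin 4, ptuPlateau (-((ptuR p : ℝ) * a)) ((ptuR p : ℝ) * a) ((ptuR p : ℝ) * a / 4)
      ((y ij.1 - y ij.2) μ))

/-- The OUTER weight: `1 - ∏ᵢ ∏_μ plateau(-aL/4, aL/4, aL/8)(yᵢμ)`; `= 1` iff some `|yᵢμ| ≥ aL/4`, `= 0` iff all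
`|yᵢμ| ≤ aL/8`. [folklore] -/
def ptuOut (a : ℝ) (L p : ℕ) (y : (Fin p → EuclideanSpace ℝ (Fin 4))) : ℝ :=
  1 - ∏ i : Fin p, ∏ μ : Fin 4, ptuPlateau (-(a * (L : ℝ) / 4)) (a * (L : ℝ) / 4) (a * (L : ℝ) / 8) (y i μ)

/-- The `(2p+1)^4` integer offsets `v = j·d(m,p)`, `j ∈ {0,…,2p}^4`. [folklore] -/
def ptuOffsets (m p : ℕ) : Finset (Fin 4 → ℤ) :=
  Finset.univ.image fun j : Fin 4 → Fin (2 * p + 1) => fun μ => ((j μ : ℕ) : ℤ) * (ptuD m p : ℤ)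

/-- A finite box of cell indices containing every cell of the central half-box. [folklore] -/
def ptuCellBox (L : ℕ) : Finset (Fin 4 → ℤ) :=
  Fintype.piFinset fun _ : Fin 4 => Finset.Icc (-(4 * (L : ℤ) + 4)) (4 * (L : ℤ) + 4)

/-- The level-`m` index set: offsets `v` and cell assignments `z : Fin p → ℤ⁴` with every cell in the central half-box,
all pairs of cell indices `≥ 16` apart and the closest pair `≤ 56` apart (sup norm on `ℤ⁴`). [folklore] -/
def ptuIdx (L m p : ℕ) : Finset ((Fin 4 → ℤ) × (Fin p → Fin 4 → ℤ)) :=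
  ((ptuOffsets m p) ×ˢ Fintype.piFinset (fun _ : Fin p => ptuCellBox L)).filter fun vz =>
    (∀ i : Fin p, CellInHalfBox L m vz.1 (vz.2 i)) ∧ (∀ i j : Fin p, i ≠ j → (16 : ℝ) ≤ ‖vz.2 i - vz.2 j‖) ∧
      ∃ i j : Fin p, i ≠ j ∧ ‖vz.2 i - vz.2 j‖ ≤ (56 : ℝ)

/-- The Whitney levels `m₀(p) ≤ m < log₃(2L+1)` (for triadic `L`, `2L+1 = 3^M`, exactly the admissible levels `≥ m₀`).
[folklore] -/
def ptuLevels (L p : ℕ) : Finset ℕ := (Finset.range (Nat.log 3 (2 * L + 1))).filter fun m => ptuM0 p ≤ m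

/-- The global normaliser `W = near + out + ∑_levels ∑_idx φ*` (`≥ 1` everywhere by coverage). [folklore] -/
def ptuW (a : ℝ) (L p : ℕ) (y : (Fin p → EuclideanSpace ℝ (Fin 4))) : ℝ :=
  ptuNear a p y + ptuOut a L p y + ∑ m ∈ ptuLevels L p, ∑ vz ∈ ptuIdx L m p, ptuPhiStar a m p vz.1 vz.2 y

/-- The weight of the far piece `(m, v, z)`: `φ̃_{m,v,z} / W`. [folklore] -/
def ptuWeight (a : ℝ) (L p m : ℕ) (v : Fin 4 → ℤ) (z : Fin p → Fin 4 → ℤ) (y : (Fin p → EuclideanSpace ℝ (Fin 4))) : ℝ :=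
  ptuPhiTilde a m p v z y / ptuW a L p y

/-! ## §2 Definitional glue (proved) -/

/-- The plateau bump is smooth in `t`. [folklore] -/
theorem ptuPlateau_contDiff (lo hi w : ℝ) : ContDiff ℝ ∞ (ptuPlateau lo hi w) := by
  have hθ := ptuStep_spec.1
  show ContDiff ℝ ∞ fun t => ptuStep ((t - lo) / w) * ptuStep ((hi - t) / w)
  exact (hθ.comp ((contDiff_id.sub contDiff_const).div_const w)).mul
    (hθ.comp ((contDiff_const.sub contDiff_id).div_const w))

/-- The plateau bump takes values in `[0, 1]`. [folklore] -/
theorem ptuPlateau_mem (lo hi w t : ℝ) : 0 ≤ ptuPlateau lo hi w t ∧ ptuPlateau lo hi w t ≤ 1 := by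
  have h := ptuStep_spec.2.2.2.1
  unfold ptuPlateau
  exact ⟨mul_nonneg (h _).1 (h _).1, mul_le_one₀ (h _).2 (h _).1 (h _).2⟩

/-- Where the plateau bump is non-zero, `t` lies between `lo` and `hi`. [folklore] -/
theorem ptuPlateau_mem_uIcc {lo hi w t : ℝ} (h : ptuPlateau lo hi w t ≠ 0) : t ∈ Set.uIcc lo hi := by
  have hz := ptuStep_spec.2.1
  unfold ptuPlateau at h
  have h1 : 0 < (t - lo) / w := by
    by_contra hc
    exact h (by rw [hz _ (not_lt.1 hc), zero_mul])
  have h2 : 0 < (hi - t) / w := by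
    by_contra hc
    exact h (by rw [hz _ (not_lt.1 hc), mul_zero])
  rcases div_pos_iff.1 h1 with ⟨h1a, h1b⟩ | ⟨h1a, h1b⟩ <;> rcases div_pos_iff.1 h2 with ⟨h2a, h2b⟩ | ⟨h2a, h2b⟩
  · exact Set.mem_uIcc.2 (Or.inl ⟨by linarith, by linarith⟩)
  · linarith
  · linarith
  · exact Set.mem_uIcc.2 (Or.inr ⟨by linarith, by linarith⟩)

/-- On `[lo + w, hi - w]` (`w > 0`) the plateau bump is `1`. [folklore] -/
theorem ptuPlateau_eq_one {lo hi w t : ℝ} (hw : 0 < w) (h1 : lo + w ≤ t) (h2 : t ≤ hi - w) :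
    ptuPlateau lo hi w t = 1 := by
  have ho := ptuStep_spec.2.2.1
  unfold ptuPlateau
  rw [ho _ (by rw [le_div_iff₀ hw]; linarith), ho _ (by rw [le_div_iff₀ hw]; linarith), mul_one]

/-- Outside `(lo, hi)` (`w > 0`) the plateau bump is `0`. [folklore] -/
theorem ptuPlateau_eq_zero {lo hi w t : ℝ} (hw : 0 < w) (h : t ≤ lo ∨ hi ≤ t) : ptuPlateau lo hi w t = 0 := by
  have hz := ptuStep_spec.2.1
  unfold ptuPlateau
  rcases h with h | h
  · rw [hz _ (div_nonpos_of_nonpos_of_nonneg (by linarith) hw.le), zero_mul]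
  · rw [hz ((hi - t) / w) (div_nonpos_of_nonpos_of_nonneg (by linarith) hw.le), mul_zero]

/-- The one-point cut-offs are smooth. [folklore] -/
theorem ptuCut_contDiff (a : ℝ) (m : ℕ) (v z : Fin 4 → ℤ) (e w : ℝ) : ContDiff ℝ ∞ (ptuCut a m v z e w) := by
  unfold ptuCut
  exact contDiff_prod fun μ _ => (ptuPlateau_contDiff _ _ _).comp (contDiff_piLp_apply (p := 2) (i := μ))

/-- Where a one-point cut-off is non-zero, every coordinate lies in the corresponding (unordered) wall interval.
[folklore] -/
theorem ptuCut_mem_uIcc {a : ℝ} {m : ℕ} {v z : Fin 4 → ℤ} {e w : ℝ} {u : EuclideanSpace ℝ (Fin 4)} (h : ptuCut a m v z e w u ≠ 0)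
    (μ : Fin 4) :
    u μ ∈ Set.uIcc (a * ((v μ : ℝ) + cellSide m * (z μ : ℝ) + e)) (a * ((v μ : ℝ) + cellSide m * ((z μ : ℝ) + 1) - e)) := by
  unfold ptuCut at h
  exact ptuPlateau_mem_uIcc ((Finset.prod_ne_zero_iff.1 h) μ (Finset.mem_univ μ))

/-- The one-point cut-offs have compact support (they vanish off a bounded box). [folklore] -/
theorem ptuCut_hasCompactSupport (a : ℝ) (m : ℕ) (v z : Fin 4 → ℤ) (e w : ℝ) :
    HasCompactSupport (ptuCut a m v z e w) := by
  set M : ℝ := ∑ μ : Fin 4, (|a * ((v μ : ℝ) + cellSide m * (z μ : ℝ) + e)| +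
    |a * ((v μ : ℝ) + cellSide m * ((z μ : ℝ) + 1) - e)|) with hM
  have hK := NuclearExpansion.isCompact_box (ContinuousLinearEquiv.refl ℝ (EuclideanSpace ℝ (Fin 4))) M
  refine HasCompactSupport.intro hK fun u hu => ?_
  by_contra hne
  refine hu fun c => ?_
  have hc := ptuCut_mem_uIcc hne c
  simp only [ContinuousLinearEquiv.coe_refl', id_eq]
  have hterm : ∀ μ : Fin 4, 0 ≤ |a * ((v μ : ℝ) + cellSide m * (z μ : ℝ) + e)| +
      |a * ((v μ : ℝ) + cellSide m * ((z μ : ℝ) + 1) - e)| := fun μ => by positivity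
  have hle : |a * ((v c : ℝ) + cellSide m * (z c : ℝ) + e)| + |a * ((v c : ℝ) + cellSide m * ((z c : ℝ) + 1) - e)| ≤ M :=
    Finset.single_le_sum (f := fun μ : Fin 4 => |a * ((v μ : ℝ) + cellSide m * (z μ : ℝ) + e)| +
      |a * ((v μ : ℝ) + cellSide m * ((z μ : ℝ) + 1) - e)|) (fun μ _ => hterm μ) (Finset.mem_univ c)
  have hn1 := neg_abs_le (a * ((v c : ℝ) + cellSide m * (z c : ℝ) + e))
  have hn2 := neg_abs_le (a * ((v c : ℝ) + cellSide m * ((z c : ℝ) + 1) - e))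
  have hs1 := le_abs_self (a * ((v c : ℝ) + cellSide m * (z c : ℝ) + e))
  have hs2 := le_abs_self (a * ((v c : ℝ) + cellSide m * ((z c : ℝ) + 1) - e))
  have ha1 := abs_nonneg (a * ((v c : ℝ) + cellSide m * (z c : ℝ) + e))
  have ha2 := abs_nonneg (a * ((v c : ℝ) + cellSide m * ((z c : ℝ) + 1) - e))
  rcases Set.mem_uIcc.1 hc with ⟨h1, h2⟩ | ⟨h1, h2⟩
  · rw [abs_le]; constructor <;> linarith
  · rw [abs_le]; constructor <;> linarith

/-- The inner cut-off as a REAL SCHWARTZ FUNCTION (the `χᵢ` fed to `localBound_of_productBound`). [folklore] -/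
def ptuChi (a : ℝ) (m p : ℕ) (v z : Fin 4 → ℤ) : 𝓢(EuclideanSpace ℝ (Fin 4), ℝ) :=
  (ptuCut_hasCompactSupport a m v z (2 + (ptuD m p : ℝ) / 8) ((ptuD m p : ℝ) / 8)).toSchwartzMap
    (ptuCut_contDiff a m v z (2 + (ptuD m p : ℝ) / 8) ((ptuD m p : ℝ) / 8))

/-- `ptuChi` is `ptuChiFun`. [folklore] -/
@[simp] theorem ptuChi_apply (a : ℝ) (m p : ℕ) (v z : Fin 4 → ℤ) (u : EuclideanSpace ℝ (Fin 4)) :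
    ptuChi a m p v z u = ptuChiFun a m p v z u := rfl

/-- The tensor bumps are smooth. [folklore] -/
theorem ptuPhiTilde_contDiff (a : ℝ) (m p : ℕ) (v : Fin 4 → ℤ) (z : Fin p → Fin 4 → ℤ) :
    ContDiff ℝ ∞ (ptuPhiTilde a m p v z) := by
  unfold ptuPhiTilde ptuChiTildeFun
  exact contDiff_prod fun i _ => (ptuCut_contDiff _ _ _ _ _ _).comp
    (ContinuousLinearMap.proj (R := ℝ) (φ := fun _ : Fin p => EuclideanSpace ℝ (Fin 4)) i).contDiff

end Summit.QuantumFields.YangMills.Theorems.ContinuumLegGivenGap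

end
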